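import Mathlib

/-!
# Cesàro pair-count weights of the discrete-momentum construction tend to one

For the joint spectral measure of the critical two-point function (line `Sketch`, canonical-lift
spine), the finite-`N` approximants represent the Cesàro-weighted two-point function with weights
`#{(x, y) ∈ [0,N)² × [0,N)² : x - y = z} / N²`.  This file proves the elementary fact that these
weights tend to `1` as `N → ∞` for every fixed `z ∈ ℤ²`.

The proof is the exact count: `(x, y) ↦ y` is a bijection from the pairs with `x - y = z` onto the
product of intervals `∏ᵢ [max 0 (-zᵢ), min N (N - zᵢ))`, whose cardinality is `∏ᵢ (N - |zᵢ|)` as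
soon as `N ≥ |z|_∞`; then `∏ᵢ (1 - |zᵢ| / N) → 1`.
-/

noncomputable section

open MeasureTheory Filter Topology
open scoped BigOperators

namespace Summit.CriticalPhenomena.Ising3DConformalLimit.Theorems

namespace CriticalTwoPointGSMJs.JsPairCountTendsto

/-- The pair count `#{(x, y) ∈ [0,N)² × [0,N)² : x - y = z}` equals the cardinality of the shifted
box `{y ∈ [0,N)² : y + z ∈ [0,N)²} = ∏ᵢ [max 0 (-zᵢ), min N (N - zᵢ))`, via the bijection
`(x, y) ↦ y` with inverse `y ↦ (y + z, y)`. -/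
lemma card_filter_eq_card_shiftedBox (z : Fin 2 → ℤ) (N : ℕ) :
    (((Fintype.piFinset (fun _ : Fin 2 => Finset.Ico (0 : ℤ) N)) ×ˢ
        (Fintype.piFinset (fun _ : Fin 2 => Finset.Ico (0 : ℤ) N))).filter
        (fun xy => xy.1 - xy.2 = z)).card =
      (Fintype.piFinset
        (fun i : Fin 2 => Finset.Ico (max 0 (-z i)) (min (N : ℤ) (N - z i)))).card := by
  refine Finset.card_nbij' (fun xy => xy.2) (fun y => (y + z, y)) ?_ ?_ ?_ ?_
  · rintro ⟨x, y⟩ hxy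
    simp only [Finset.mem_coe, Finset.mem_filter, Finset.mem_product, Fintype.mem_piFinset,
      Finset.mem_Ico] at hxy
    simp only [Finset.mem_coe, Fintype.mem_piFinset, Finset.mem_Ico, max_le_iff, lt_min_iff]
    obtain ⟨⟨hx, hy⟩, hz⟩ := hxy
    intro i
    have hxi := hx i
    have hyi := hy i
    have hzi : x i - y i = z i := by rw [← hz]; rfl
    omega
  · intro y hy
    simp only [Finset.mem_coe, Fintype.mem_piFinset, Finset.mem_Ico, max_le_iff,
      lt_min_iff] at hy
    simp only [Finset.mem_coe, Finset.mem_filter, Finset.mem_product, Fintype.mem_piFinset,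
      Finset.mem_Ico, Pi.add_apply, add_sub_cancel_left, and_true]
    refine ⟨fun i => ?_, fun i => ?_⟩
    · have hyi := hy i
      omega
    · have hyi := hy i
      omega
  · rintro ⟨x, y⟩ hxy
    simp only [Finset.mem_coe, Finset.mem_filter] at hxy
    obtain ⟨-, rfl⟩ := hxy
    exact Prod.ext (by abel) rfl
  · intro y _
    rfl

/-- For `N ≥ |z|_∞` the shifted box has exactly `∏ᵢ (N - |zᵢ|)` points (as a real number). -/
lemma card_shiftedBox (z : Fin 2 → ℤ) (N : ℕ) (hN : ∀ i, |z i| ≤ N) :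
    ((Fintype.piFinset
        (fun i : Fin 2 => Finset.Ico (max 0 (-z i)) (min (N : ℤ) (N - z i)))).card : ℝ) =
      ∏ i : Fin 2, ((N : ℝ) - |(z i : ℝ)|) := by
  rw [Fintype.card_piFinset, Nat.cast_prod]
  refine Finset.prod_congr rfl (fun i _ => ?_)
  rw [Int.card_Ico]
  have h1 : min (N : ℤ) (N - z i) - max 0 (-z i) = N - |z i| := by
    rcases le_or_gt 0 (z i) with h | h
    · rw [abs_of_nonneg h, min_eq_right (by omega), max_eq_left (by omega)]
      ring
    · rw [abs_of_neg h, min_eq_left (by omega), max_eq_right (by omega)]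
  rw [h1]
  have h2 : (0 : ℤ) ≤ N - |z i| := by have := hN i; omega
  have h3 : (((N - |z i|).toNat : ℤ) : ℝ) = ((N - |z i| : ℤ) : ℝ) := by
    rw [Int.toNat_of_nonneg h2]
  rw [Int.cast_natCast] at h3
  rw [h3]
  push_cast
  ring

/-- Eventually (in `N`) every coordinate of `z` is at most `N` in absolute value and `N ≥ 1`. -/
lemma eventually_abs_le (z : Fin 2 → ℤ) :
    ∀ᶠ N : ℕ in atTop, (∀ i, |z i| ≤ N) ∧ 1 ≤ N := by
  filter_upwards [eventually_ge_atTop (∑ i, (z i).natAbs + 1)] with N hN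
  refine ⟨fun i => ?_, by omega⟩
  have hi : (z i).natAbs ≤ ∑ j, (z j).natAbs :=
    Finset.single_le_sum (f := fun j => (z j).natAbs) (fun j _ => Nat.zero_le _) (Finset.mem_univ i)
  rw [← Int.natCast_natAbs]
  exact_mod_cast (by omega : (z i).natAbs ≤ N)

/-- The closed form `(1 - |z₀| / N) * (1 - |z₁| / N)` tends to `1`. -/
lemma tendsto_closedForm (z : Fin 2 → ℤ) :
    Tendsto (fun N : ℕ => (1 - |(z 0 : ℝ)| / (N : ℝ)) * (1 - |(z 1 : ℝ)| / (N : ℝ))) atTop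
      (𝓝 1) := by
  have h : ∀ c : ℝ, Tendsto (fun N : ℕ => 1 - c / (N : ℝ)) atTop (𝓝 1) := fun c => by
    have h1 := (tendsto_const_div_atTop_nhds_zero_nat c).const_sub (1 : ℝ)
    rwa [sub_zero] at h1
  have h2 := (h |(z 0 : ℝ)|).mul (h |(z 1 : ℝ)|)
  rwa [mul_one] at h2

end CriticalTwoPointGSMJs.JsPairCountTendsto

open CriticalTwoPointGSMJs.JsPairCountTendsto in
/-- **The Cesàro weights tend to one.** For fixed `z ∈ ℤ²`,
`#{(x,y) ∈ [0,N)²×[0,N)² : x - y = z} / N² → 1` as `N → ∞` (the count is `∏ᵢ (N - |zᵢ|)` once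
`N ≥ |z|_∞`). -/
theorem js_pairCount_tendsto : ∀ z : Fin 2 → ℤ,
    Tendsto (fun N : ℕ =>
      ((((Fintype.piFinset (fun _ : Fin 2 => Finset.Ico (0 : ℤ) N)) ×ˢ
          (Fintype.piFinset (fun _ : Fin 2 => Finset.Ico (0 : ℤ) N))).filter
          (fun xy => xy.1 - xy.2 = z)).card : ℝ) / (N : ℝ) ^ 2) atTop (𝓝 1) := by
  intro z
  refine (tendsto_closedForm z).congr' ?_
  filter_upwards [eventually_abs_le z] with N hN
  obtain ⟨hz, hN1⟩ := hN
  rw [card_filter_eq_card_shiftedBox, card_shiftedBox z N hz, Fin.prod_univ_two]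
  have hNpos : (0 : ℝ) < N := by exact_mod_cast hN1
  field_simp

end Summit.CriticalPhenomena.Ising3DConformalLimit.Theorems

end
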